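import Summits.AtomisticToContinuum.FouriersLaw.Theses.BondHeatUncertainty

/-!
# `BondHeatUncertainty.TransferToBoundedResponse` — PROVED

Route `AtomisticToContinuum/FouriersLaw/BondHeatUncertainty`, support item `stmt-AtomisticToContinuum-9655`
(`TransferToBoundedResponse`): the glue

  `SubdiffusiveBondHeat → ExtensiveSnapshotIrreversibility → LinearResponseFTUR → NessUnique → BoundedResponse`.

All four hypotheses are route decls BY NAME; the conclusion is the shared waypoint `BoundedResponse`
(`|D_N|` bounded in `N` along every steady-state family with response limits `D_N`).

## Proof (pure real arithmetic, as in the route thesis)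

Fix parameters, a steady-state family `μ`, `T > 0` and response coefficients `D`.  `NessUnique` feeds the
uniqueness hypothesis of `(K)` and `(★)`.  `(K)` gives `C` with `KL(μ_{N,δ} ‖ Θ_*μ_{N,δ}) ≤ C·N·δ²` eventually;
monotonicity of `ENNReal.ofReal` upgrades this to the `K`-hypothesis of `(★b)` with `K = max(C,0)·N ≥ 0`.
`(S)` gives `A`, `c > 0`, `N₀` and, for `N ≥ N₀`, a bond `b` with `V_N(b,t) ≤ A√t` on `1 ≤ t ≤ cN²`.
For `N ≥ max(N₀, 2, ⌈1/c⌉₊)` put `t = cN²` (then `1 ≤ cN ≤ t`), `G = D_N/(N-1) ≥ 0` (by `(★a)`), so the factor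
`G t/T² + K` is `≥ 0` and `V` may be replaced by `max(A,0)·√t = max(A,0)·√c·N` in `(★b)` WITHOUT any sign
information on `V`:

  `2 G² c² N⁴ ≤ max(A,0) √c N (G c N²/T² + max(C,0) N)`.

Dividing by `N²` and writing `x = G·N ≥ 0`: `2c² x² ≤ P x + Q` with `P = max(A,0) c √c/T² ≥ 0`,
`Q = max(A,0) √c max(C,0) ≥ 0`, hence `x ≤ max(1, (P+Q)/(2c²))`; and `0 ≤ D_N = G (N-1) ≤ G N = x`.
Finitely many small `N` are absorbed (`IsBoundedUnder.bddAbove_range`).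

No named facts are used; the theorem is unconditional glue.  Sources of the line: Hasegawa–Van Vu 2019
(the FTUR behind `(★)`), Bonetto–Lebowitz–Rey-Bellet 2000 (bounded response as the missing step of Fourier's law).
-/

namespace Summit.AtomisticToContinuum.FouriersLaw.Theorems

open Filter Set
open Summit.AtomisticToContinuum.FouriersLaw.Theses.BondHeatUncertainty

/-- Elementary quadratic bound: if `0 < a`, `0 ≤ Q` and `a x² ≤ P x + Q`, then `x ≤ max 1 ((P + Q)/a)`
(for `x > 1`, `Q ≤ Q x`, so `a x ≤ P + Q`). [folklore] -/
theorem le_max_of_quadratic_le {x a P Q : ℝ} (ha : 0 < a) (hQ : 0 ≤ Q)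
    (h : a * x ^ 2 ≤ P * x + Q) : x ≤ max 1 ((P + Q) / a) := by
  rcases le_or_gt x 1 with hx1 | hx1
  · exact hx1.trans (le_max_left _ _)
  · refine le_trans ?_ (le_max_right _ _)
    rw [le_div_iff₀ ha]
    have hQx : Q ≤ Q * x := le_mul_of_one_le_right hQ hx1.le
    have hxpos : 0 < x := lt_trans zero_lt_one hx1
    have h2 : a * x * x ≤ (P + Q) * x := by nlinarith [h, hQx]
    have h3 : a * x ≤ P + Q := le_of_mul_le_mul_right h2 hxpos
    linarith [h3]

/-- **Abstract transfer arithmetic.** For real sequences `D` (response coefficients), an abstract bond-heat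
variance `V N b t`, an abstract snapshot irreversibility `kl N δ : ℝ≥0∞` and constants `T, c > 0`:
if (S) for `N ≥ N₀` some bond `b` (`b + 1 < N`) has `V N b t ≤ A √t` on `1 ≤ t ≤ c N²`; (K) for every `N`,
eventually as `δ → 0`, `δ ≠ 0`, `kl N δ ≤ C·N·δ²`; and (★) for `N ≥ 2`, `0 ≤ D N` and
`2 (D N/(N-1))² t² ≤ V N b t · (D N/(N-1) · t/T² + K)` for every bond, every `t > 0` and every `K ≥ 0`
with `kl N δ ≤ K δ²` eventually — then `N ↦ |D N|` is bounded above, with the explicit bound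
`max 1 ((P+Q)/(2c²))`, `P = max(A,0) c √c/T²`, `Q = max(A,0) √c max(C,0)`, beyond `max(N₀,2,⌈1/c⌉₊)`.
[folklore] -/
theorem bddAbove_abs_of_transfer {D : ℕ → ℝ} {V : ℕ → ℕ → ℝ → ℝ} {kl : ℕ → ℝ → ENNReal}
    {A c C T : ℝ} {N₀ : ℕ} (hc : 0 < c) (hT : 0 < T)
    (hS : ∀ N : ℕ, N₀ ≤ N → ∃ b : ℕ, b + 1 < N ∧
      ∀ t : ℝ, 1 ≤ t → t ≤ c * (N : ℝ) ^ 2 → V N b t ≤ A * Real.sqrt t)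
    (hK : ∀ N : ℕ, ∀ᶠ δ in nhdsWithin (0 : ℝ) {(0 : ℝ)}ᶜ, kl N δ ≤ ENNReal.ofReal (C * (N : ℝ) * δ ^ 2))
    (hF : ∀ N : ℕ, 2 ≤ N → 0 ≤ D N ∧ ∀ b : ℕ, b + 1 < N → ∀ t : ℝ, 0 < t → ∀ K : ℝ, 0 ≤ K →
      (∀ᶠ δ in nhdsWithin (0 : ℝ) {(0 : ℝ)}ᶜ, kl N δ ≤ ENNReal.ofReal (K * δ ^ 2)) →
      2 * (D N / ((N : ℝ) - 1)) ^ 2 * t ^ 2 ≤ V N b t * (D N / ((N : ℝ) - 1) * t / T ^ 2 + K)) :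
    BddAbove (Set.range fun N => |D N|) := by
  -- constants
  set A' : ℝ := max A 0 with hA'
  set C' : ℝ := max C 0 with hC'
  have hA'0 : 0 ≤ A' := le_max_right _ _
  have hC'0 : 0 ≤ C' := le_max_right _ _
  have hsc0 : 0 ≤ Real.sqrt c := Real.sqrt_nonneg _
  set P : ℝ := A' * c * Real.sqrt c / T ^ 2 with hP
  set Q : ℝ := A' * Real.sqrt c * C' with hQ
  have hQ0 : 0 ≤ Q := by positivity
  set B : ℝ := max 1 ((P + Q) / (2 * c ^ 2)) with hB
  set M : ℕ := max (max N₀ 2) ⌈1 / c⌉₊ with hM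
  -- the eventual bound
  have hbound : ∀ N : ℕ, M ≤ N → |D N| ≤ B := by
    intro N hN
    have hN₀ : N₀ ≤ N := le_trans (le_trans (le_max_left _ _) (le_max_left _ _)) hN
    have hN2 : 2 ≤ N := le_trans (le_trans (le_max_right _ _) (le_max_left _ _)) hN
    have hNc : ⌈1 / c⌉₊ ≤ N := le_trans (le_max_right _ _) hN
    have hN2r : (2 : ℝ) ≤ N := by exact_mod_cast hN2
    have hNpos : (0 : ℝ) < N := by linarith
    have hN1 : (1 : ℝ) ≤ (N : ℝ) - 1 := by linarith
    have hcN : 1 ≤ c * (N : ℝ) := by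
      have h1 : 1 / c ≤ (N : ℝ) := Nat.ceil_le.mp hNc
      rw [div_le_iff₀ hc] at h1
      linarith
    -- the Thouless time
    set t : ℝ := c * (N : ℝ) ^ 2 with ht
    have ht1 : 1 ≤ t := by
      have : c * (N : ℝ) ≤ c * (N : ℝ) ^ 2 := by nlinarith
      linarith
    have htpos : 0 < t := lt_of_lt_of_le zero_lt_one ht1
    have hsqrt : Real.sqrt t = Real.sqrt c * (N : ℝ) := by
      rw [ht, Real.sqrt_mul hc.le, Real.sqrt_sq hNpos.le]
    -- the bond of (S) and its variance bound at the Thouless time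
    obtain ⟨b, hb, hV⟩ := hS N hN₀
    have hVt : V N b t ≤ A' * Real.sqrt t :=
      (hV t ht1 le_rfl).trans (mul_le_mul_of_nonneg_right (le_max_left _ _) (Real.sqrt_nonneg _))
    -- the FTUR at K = C' N
    obtain ⟨hD0, hFb⟩ := hF N hN2
    have hKN : ∀ᶠ δ in nhdsWithin (0 : ℝ) {(0 : ℝ)}ᶜ, kl N δ ≤ ENNReal.ofReal (C' * (N : ℝ) * δ ^ 2) := by
      filter_upwards [hK N] with δ hδ
      refine hδ.trans (ENNReal.ofReal_le_ofReal ?_)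
      have : C * (N : ℝ) ≤ C' * (N : ℝ) := mul_le_mul_of_nonneg_right (le_max_left _ _) hNpos.le
      nlinarith [sq_nonneg δ]
    have hKN0 : 0 ≤ C' * (N : ℝ) := mul_nonneg hC'0 hNpos.le
    have hin := hFb b hb t htpos (C' * (N : ℝ)) hKN0 hKN
    -- conductance G = D_N/(N-1) ≥ 0, factor ≥ 0
    set G : ℝ := D N / ((N : ℝ) - 1) with hG
    have hG0 : 0 ≤ G := div_nonneg hD0 (by linarith)
    have hf0 : 0 ≤ G * t / T ^ 2 + C' * (N : ℝ) := by positivity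
    have h3 : 2 * G ^ 2 * t ^ 2 ≤ A' * Real.sqrt t * (G * t / T ^ 2 + C' * (N : ℝ)) :=
      hin.trans (mul_le_mul_of_nonneg_right hVt hf0)
    rw [hsqrt] at h3
    -- x = G N satisfies 2c² x² ≤ P x + Q
    set x : ℝ := G * (N : ℝ) with hx
    have key : (N : ℝ) ^ 2 * ((2 * c ^ 2) * x ^ 2) ≤ (N : ℝ) ^ 2 * (P * x + Q) := by
      have e1 : (N : ℝ) ^ 2 * ((2 * c ^ 2) * x ^ 2) = 2 * G ^ 2 * t ^ 2 := by
        simp only [hx, ht]; ring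
      have e2 : (N : ℝ) ^ 2 * (P * x + Q) = A' * (Real.sqrt c * (N : ℝ)) * (G * t / T ^ 2 + C' * (N : ℝ)) := by
        simp only [hx, ht, hP, hQ]; ring
      rw [e1, e2]; exact h3
    have hq : (2 * c ^ 2) * x ^ 2 ≤ P * x + Q := le_of_mul_le_mul_left key (pow_pos hNpos 2)
    have hxB : x ≤ B := le_max_of_quadratic_le (by positivity) hQ0 hq
    -- 0 ≤ D_N = G (N-1) ≤ G N = x
    have hDx : D N ≤ x := by
      have hDG : D N = G * ((N : ℝ) - 1) := by
        rw [hG, div_mul_cancel₀]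
        exact ne_of_gt (by linarith)
      rw [hDG, hx]; nlinarith
    rw [abs_of_nonneg hD0]
    exact hDx.trans hxB
  -- finitely many small N are absorbed
  have hbu : IsBoundedUnder (· ≤ ·) atTop fun N => |D N| := ⟨B, eventually_atTop.2 ⟨M, hbound⟩⟩
  exact hbu.bddAbove_range

/-- **`BondHeatUncertainty.TransferToBoundedResponse`, PROVED** (item `stmt-AtomisticToContinuum-9655`): the
√t equilibrium bond-heat variance bound up to the Thouless time `(S)`, extensive snapshot irreversibility `(K)`,
the fixed-`N` linear-response fluctuation-theorem uncertainty relation `(★)` and weak-NESS uniqueness give bounded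
response `0 ≤ D_N ≤ B` along every steady-state family of `pinnedChain ω₂ lam β γ` (all parameters `> 0`), i.e. the
shared waypoint `BoundedResponse`.  Real arithmetic at `t = cN²`, `K = max(C,0)·N` (`bddAbove_abs_of_transfer`).
[folklore] -/
theorem transferToBoundedResponse_proof :
    Summit.AtomisticToContinuum.FouriersLaw.Theses.BondHeatUncertainty.TransferToBoundedResponse := by
  intro hS hK hF hU ω₂ lam β γ hω hl hβ hγ μ hμ T hT D hD
  have huniq := hU ω₂ lam β γ hω hl hβ hγ
  obtain ⟨C, hC⟩ := hK ω₂ lam β γ hω hl hβ hγ huniq μ hμ T hT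
  obtain ⟨A, c, hc, N₀, hSN⟩ := hS ω₂ lam β γ hω hl hβ hγ T hT
  have hFN := hF ω₂ lam β γ hω hl hβ hγ huniq μ hμ T hT D hD
  exact bddAbove_abs_of_transfer hc hT hSN hC hFN

end Summit.AtomisticToContinuum.FouriersLaw.Theorems
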